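import Literature.AlgebraicGeometry.HodgeTheory.SubvariationHodgeNumbersConstant
import Literature.AlgebraicGeometry.HodgeTheory.MonodromyReducibleSubvariation
import Literature.AlgebraicGeometry.HodgeTheory.ClassesSupportedOnComplexification
import HarnessLib

/-!
# A sub-variation whose `F^p`-line has full flat span near one member is irreducible under every
# finite-index monodromy subgroup (Voisin I Prop. 9.20 over Griffiths' holomorphy + Deligne 1987 §1.12–1.13)

Family `hodge`, layer `Literature/AlgebraicGeometry/HodgeTheory`; THEOREMS ONLY (no definition, no
new named fact). This is the CONSUMER of the cell `hodge-nonav`'s criterion (C44) «FS-LEMMA» (memo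
`ROUTE-P3v28-g37.md` §7, route `HodgeConjecture/Q8SymplecticPowers`, crux K1Q stub S4 (iii)): it
assembles the tree's

* `flatSplitting_finrank_inf_F_eq_local` (`SubvariationHodgeNumbersConstant`: the Hodge numbers of the
  pieces of a flat splitting by Hodge subspaces are locally constant — Voisin I Prop. 9.20 over the
  proved Griffiths theorem `griffiths1968_holomorphicHodgeSubbundlesQP_holds`),
* `HodgeStructure.F_eq_iSup_inf_of_splitting` (ibid. §3: such a splitting splits every `F^p`),
* the relative Lemma E and the sub-variation complements over Deligne 1987 Prop. 1.13 = the named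
  fact `deligne1987_monodromy_directSum_irreducible_subvariations` (FACT B)
  (`MonodromyReducibleSubvariation`: `isTransportIrreducible_of_forall_subvariation_eq`,
  `exists_isCompl_subvariation`, `exists_isCompl_subvariation_le`),
* the dictionary `σ : π₁(S(ℂ), s) → Γ_s` (`MonodromySemisimpleSubvariations` Part IV),

into ONE statement: **if `M ⊆ Hᵏ(X_s)` is a non-zero `H`-stable complex sub-variation (`H ≤ π₁` of
finite index) with `dim(M ∩ F^p) ≤ 1`, and no proper subspace of `M` contains the lines
`M ∩ F^p(X_t)` (pulled back to `s` by flat transport) for all members `t` near `s`, then `M` is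
`H`-irreducible** — granted FACT B. The argument (5 lines in print): were `M` reducible, Deligne's
complete reducibility by sub-variations gives a flat splitting `M = K ⊕ K'` inside `Hᵏ = M ⊕ M'` by
`H`-stable sub-variations; `t ↦ dim(K ∩ F^p(X_t))`, `dim(K' ∩ F^p(X_t))` are locally constant and add
up to `dim(M ∩ F^p) ≤ 1`, so one of them vanishes near `s` and `M ∩ F^p(X_t)` lies in the other
(proper) piece for all nearby `t` — contradicting the hypothesis.

## Contents

* §1 Bridges `ℂ ⊗_ℚ Hᵏ(X_s; ℚ) ↔ Hᵏ(X_s(ℂ); ℂ)` along rational transports: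
  `ofRatClassBaseChange_baseChange_of_ratTransport` (`β_t ∘ (T ⊗ ℂ) = γ_* ∘ β_s`),
  `mem_piece_comapEquiv_iff_transportFun_mem_typePiece` (the Hodge pieces of `X_t` pulled back by
  `T` are the preimages of the type pieces under `γ_* ∘ β_s`),
  `comap_eq_iSup_inf_piece_comapEquiv_of_isHodgeSubspace_map` (a subspace whose transport is a
  Hodge subspace of `Hᵏ(X_t)` is compatible with the pulled-back Hodge structure — the hypothesis
  `hK` of `SubvariationHodgeNumbersConstant` §3).
* §2 Pure Hodge-structure algebra for a three-piece splitting `V_ℂ = K₀ ⊕ K₁ ⊕ K₂` by Hodge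
  subspaces: `HodgeStructure.F_eq_sup_three_of_splitting`, `….sup_inf_F_eq_of_splitting`
  (`(K₀ ⊕ K₁) ∩ F^p = (K₀ ∩ F^p) ⊕ (K₁ ∩ F^p)`, modular law),
  `….sum_three_finrank_inf_F_eq_of_splitting` (the additivity `hadd`).
* §3 `isTransportIrreducible_of_flatSpan` (the criterion, `π₁`-currency of FACT B) and
  `eq_bot_or_eq_of_stable_of_flatSpan` (the same in the currency of the cell's stub S4 (iii):
  `ℂ ⊗_ℚ Hᵏ(X_s; ℚ)`, finite-index `Γ' ≤ ratMonodromyGroup` acting by `γ ⊗ ℂ`), with the bridge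
  `isTransportStable_map_of_forall_baseChange_mem`.

Honest scope: the full-flat-span hypothesis (FS)_s is a HYPOTHESIS here (in the cell it is to be
supplied by an exact jet-rank certificate at one member); FACT B is a binder; nothing here touches
the Hodge conjecture.

## References
* [VoisinHodgeI2002] C. Voisin, Hodge Theory and Complex Algebraic Geometry I, CUP 2002: §9.3.1
  Prop. 9.20, §10.2.1 Thm. 10.3, §7.1.1.
* [VoisinHodgeII2003] C. Voisin, Hodge Theory and Complex Algebraic Geometry II, CUP 2003: §3.1.2
  (the rational local system and its transports).
* [Deligne1987] P. Deligne, Un théorème de finitude pour la monodromie, Progr. Math. 67 (1987),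
  §0, §1.1–1.2, §1.12–1.13.
-/

noncomputable section

open CategoryTheory AlgebraicGeometry
open _root_.Topology _root_.Filter Set Module Submodule
open scoped TensorProduct
open Literature.AlgebraicTopology.SingularHomology
open Literature.AlgebraicGeometry.Motives

namespace Literature.AlgebraicGeometry.HodgeTheory

section HodgeTheory

/-! ### §1 Bridges between `ℂ ⊗_ℚ Hᵏ(X_s; ℚ)` and `Hᵏ(X_s(ℂ); ℂ)` along rational transports -/

section Bridges

variable {𝒳 S : SchemeOver ℂ} {f : 𝒳 ⟶ S} {n k : ℕ} {U : Set (ComplexPoints S)}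
  {hU : IsCohomologicallyLocallyTrivialOn f U}

/-- **`β` intertwines a rational transport with the complex transport**: if
`T : Hᵏ(X_s; ℚ) ≃ Hᵏ(X_t; ℚ)` satisfies `(T v) ⊗ 1 = γ_* (v ⊗ 1)`, then
`β_t ∘ (T ⊗ ℂ) = γ_* ∘ β_s` on `ℂ ⊗_ℚ Hᵏ(X_s; ℚ)`. [cite: VoisinHodgeII2003, §3.1.2] -/
theorem ofRatClassBaseChange_baseChange_of_ratTransport {s t : U} {γ : Path.Homotopic.Quotient s t}
    {T : singularCohomology ℚ ℚ (ComplexPoints (fiberOver f s.1)) k ≃ₗ[ℚ]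
      singularCohomology ℚ ℚ (ComplexPoints (fiberOver f t.1)) k}
    (hT : ∀ v, ofRatClass _ k (T v) = transportFun f k hU γ (ofRatClass _ k v))
    (x : ℂ ⊗[ℚ] singularCohomology ℚ ℚ (ComplexPoints (fiberOver f s.1)) k) :
    ofRatClassBaseChange (ComplexPoints (fiberOver f t.1)) k ((T : _ →ₗ[ℚ] _).baseChange ℂ x) =
      transportFun f k hU γ (ofRatClassBaseChange (ComplexPoints (fiberOver f s.1)) k x) := by
  induction x using TensorProduct.induction_on with
  | zero =>
    rw [map_zero, map_zero]
    exact ((transportLinear f k hU γ).map_zero).symm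
  | tmul c v =>
    rw [LinearMap.baseChange_tmul, LinearEquiv.coe_coe, ofRatClassBaseChange_tmul,
      ofRatClassBaseChange_tmul, hT]
    exact ((transportLinear f k hU γ).map_smul c _).symm
  | add x y hx hy =>
    rw [map_add, map_add, hx, hy, map_add]
    exact ((transportLinear f k hU γ).map_add _ _).symm

/-- **The Hodge pieces of `X_t` pulled back to `s` by a rational transport are the preimages of the
type pieces of `Hᵏ(X_t(ℂ); ℂ)` under `γ_* ∘ β_s`**: for `p + q = k`,
`x ∈ ((A_t).hodgeStructure.comapEquiv T)^{p,q} ↔ γ_*(β_s x) ∈ H^{p,q}(X_t)` (read in the Hodge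
model `A_t`). [cite: VoisinHodgeI2002, §7.1.1 and §9.2.1] -/
theorem mem_piece_comapEquiv_iff_transportFun_mem_typePiece {s t : U}
    {γ : Path.Homotopic.Quotient s t}
    {T : singularCohomology ℚ ℚ (ComplexPoints (fiberOver f s.1)) k ≃ₗ[ℚ]
      singularCohomology ℚ ℚ (ComplexPoints (fiberOver f t.1)) k}
    (hT : ∀ v, ofRatClass _ k (T v) = transportFun f k hU γ (ofRatClass _ k v))
    (hXt : IsSmoothProjective n (fiberOver f t.1)) (A : HodgeModel n (fiberOver f t.1))
    (hA : A.IsHodgeSymmetric) (pq : ↥(Finset.HasAntidiagonal.antidiagonal k))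
    (x : ℂ ⊗[ℚ] singularCohomology ℚ ℚ (ComplexPoints (fiberOver f s.1)) k) :
    x ∈ ((A.hodgeStructure hXt hA k).comapEquiv T).piece (pq.1.1 : ℤ) (pq.1.2 : ℤ) ↔
      transportFun f k hU γ (ofRatClassBaseChange (ComplexPoints (fiberOver f s.1)) k x) ∈
        A.typePiece k pq := by
  have hpq : pq.1.1 + pq.1.2 = k := Finset.HasAntidiagonal.mem_antidiagonal.1 pq.2
  rw [Motives.HodgeStructure.comapEquiv_piece, Submodule.mem_comap, A.piece_eq_ratPiece hXt hA hpq,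
    HodgeModel.mem_ratPiece_iff, HodgeModel.complexification_apply,
    ofRatClassBaseChange_baseChange_of_ratTransport hT, HodgeModel.mem_typePiece_iff]

/-- **Hodge compatibility is transported**: if the transport `γ_* L` of `L ⊆ Hᵏ(X_s(ℂ); ℂ)` is a
Hodge subspace of `Hᵏ(X_t(ℂ); ℂ)`, then `β_s⁻¹ L ⊆ ℂ ⊗_ℚ Hᵏ(X_s; ℚ)` is the sum of its intersections
with the Hodge pieces of `X_t` pulled back to `s` by the rational transport `T` along `γ` — the
hypothesis `hK` of `HodgeStructure.sum_finrank_inf_F_eq_of_splitting` for the Hodge structure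
`(A_t).hodgeStructure.comapEquiv T`. [cite: Deligne1987, §1.1–1.2 (p. 6)] [cite: VoisinHodgeI2002, §7.1.1] -/
theorem comap_eq_iSup_inf_piece_comapEquiv_of_isHodgeSubspace_map {s t : U}
    {γ : Path.Homotopic.Quotient s t}
    {T : singularCohomology ℚ ℚ (ComplexPoints (fiberOver f s.1)) k ≃ₗ[ℚ]
      singularCohomology ℚ ℚ (ComplexPoints (fiberOver f t.1)) k}
    (hT : ∀ v, ofRatClass _ k (T v) = transportFun f k hU γ (ofRatClass _ k v))
    (hXs : IsSmoothProjective n (fiberOver f s.1)) (hXt : IsSmoothProjective n (fiberOver f t.1))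
    (A : HodgeModel n (fiberOver f t.1)) (hA : A.IsHodgeSymmetric)
    {L : Submodule ℂ (complexBetti (fiberOver f s.1) k)}
    (hL : IsHodgeSubspace n (fiberOver f t.1) k (L.map (transportLinear f k hU γ))) :
    L.comap (ofRatClassBaseChangeEquiv hXs k).toLinearMap =
      ⨆ q : ℤ, L.comap (ofRatClassBaseChangeEquiv hXs k).toLinearMap ⊓
        ((A.hodgeStructure hXt hA k).comapEquiv T).piece q ((k : ℤ) - q) := by
  -- `Φ = γ_* ∘ β_s : ℂ ⊗_ℚ Hᵏ(X_s; ℚ) ≃ Hᵏ(X_t(ℂ); ℂ)`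
  set τ : complexBetti (fiberOver f s.1) k ≃ₗ[ℂ] complexBetti (fiberOver f t.1) k :=
    LinearEquiv.ofBijective (transportLinear f k hU γ) ⟨transportLinear_injective γ,
      fun b ↦ ⟨transportFun f k hU γ.symm b, transportFun_transportFun_symm f k hU γ b⟩⟩ with hτ
  set Φ := (ofRatClassBaseChangeEquiv hXs k).trans τ with hΦ
  have hΦapply : ∀ x, Φ x = transportFun f k hU γ (ofRatClassBaseChange _ k x) := fun x ↦ rfl
  -- `β_s⁻¹ L = Φ⁻¹ (γ_* L)`
  have h1 : L.comap (ofRatClassBaseChangeEquiv hXs k).toLinearMap =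
      (L.map (transportLinear f k hU γ)).comap Φ.toLinearMap := by
    ext x
    simp only [Submodule.mem_comap, LinearEquiv.coe_coe, hΦapply, ofRatClassBaseChangeEquiv_apply]
    constructor
    · intro hx
      exact ⟨_, hx, rfl⟩
    · rintro ⟨y, hy, hyx⟩
      rw [← transportLinear_apply, (transportLinear_injective γ).eq_iff] at hyx
      exact hyx ▸ hy
  -- the pulled-back pieces are the preimages of the type pieces
  have h2 : ∀ pq : ↥(Finset.HasAntidiagonal.antidiagonal k),
      (A.typePiece k pq).comap Φ.toLinearMap =
        ((A.hodgeStructure hXt hA k).comapEquiv T).piece (pq.1.1 : ℤ) (pq.1.2 : ℤ) := by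
    intro pq
    ext x
    rw [Submodule.mem_comap, LinearEquiv.coe_coe, hΦapply,
      mem_piece_comapEquiv_iff_transportFun_mem_typePiece hT hXt A hA pq x]
  -- the Hodge decomposition of `γ_* L`, pulled back along `Φ`
  have h3 : L.comap (ofRatClassBaseChangeEquiv hXs k).toLinearMap =
      ⨆ pq : ↥(Finset.HasAntidiagonal.antidiagonal k),
        L.comap (ofRatClassBaseChangeEquiv hXs k).toLinearMap ⊓
          ((A.hodgeStructure hXt hA k).comapEquiv T).piece (pq.1.1 : ℤ) (pq.1.2 : ℤ) := by
    conv_lhs => rw [h1, hL.eq_iSup_inf_typePiece hXt A, Submodule.comap_equiv_eq_map_symm,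
      Submodule.map_iSup]
    refine iSup_congr fun pq ↦ ?_
    rw [← Submodule.comap_equiv_eq_map_symm, Submodule.comap_inf, ← h1, h2]
  refine le_antisymm (h3.le.trans ?_) (iSup_le fun q ↦ inf_le_left)
  refine iSup_le fun pq ↦ le_iSup_of_le (pq.1.1 : ℤ) (le_of_eq ?_)
  have hpq : pq.1.1 + pq.1.2 = k := Finset.HasAntidiagonal.mem_antidiagonal.1 pq.2
  have : (k : ℤ) - (pq.1.1 : ℤ) = (pq.1.2 : ℤ) := by omega
  rw [this]

end Bridges

/-! ### §2 A three-piece splitting by Hodge subspaces splits `F^p` (pure Hodge-structure algebra) -/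

section Splitting

/-- `⨆` over `Fin 3` is the triple `⊔`. [folklore] -/
private theorem iSup_fin_three {α : Type*} [CompleteLattice α] (g : Fin 3 → α) :
    ⨆ j, g j = (g 0 ⊔ g 1) ⊔ g 2 := by
  refine le_antisymm (iSup_le fun j ↦ ?_) (sup_le (sup_le (le_iSup g 0) (le_iSup g 1)) (le_iSup g 2))
  fin_cases j
  · exact le_sup_of_le_left le_sup_left
  · exact le_sup_of_le_left le_sup_right
  · exact le_sup_right

variable {V : Type*} [AddCommGroup V] [Module ℚ V] {m : ℤ} (H : Motives.HodgeStructure V m)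

/-- **A splitting `V_ℂ = K₀ + K₁ + K₂` by Hodge subspaces splits every `F^p`**:
`F^p = (K₀ ∩ F^p + K₁ ∩ F^p) + K₂ ∩ F^p` (the tree's `HodgeStructure.F_eq_iSup_inf_of_splitting`
for the family `![K₀, K₁, K₂]`). [cite: VoisinHodgeI2002, §7.1.1 and §9.3.1 Prop. 9.20] -/
theorem HodgeStructure.F_eq_sup_three_of_splitting (K₀ K₁ K₂ : Submodule ℂ (ℂ ⊗[ℚ] V))
    (htop : (K₀ ⊔ K₁) ⊔ K₂ = ⊤) (h₀ : K₀ = ⨆ q, K₀ ⊓ H.piece q (m - q))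
    (h₁ : K₁ = ⨆ q, K₁ ⊓ H.piece q (m - q)) (h₂ : K₂ = ⨆ q, K₂ ⊓ H.piece q (m - q)) (p : ℤ) :
    H.F p = (K₀ ⊓ H.F p ⊔ K₁ ⊓ H.F p) ⊔ K₂ ⊓ H.F p := by
  have htop' : ⨆ j, (![K₀, K₁, K₂] : Fin 3 → Submodule ℂ (ℂ ⊗[ℚ] V)) j = ⊤ := by
    rw [iSup_fin_three]
    exact htop
  have hK : ∀ j, (![K₀, K₁, K₂] : Fin 3 → Submodule ℂ (ℂ ⊗[ℚ] V)) j =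
      ⨆ q, (![K₀, K₁, K₂] : Fin 3 → Submodule ℂ (ℂ ⊗[ℚ] V)) j ⊓ H.piece q (m - q) := by
    intro j
    fin_cases j
    exacts [h₀, h₁, h₂]
  have hF := HodgeStructure.F_eq_iSup_inf_of_splitting H ![K₀, K₁, K₂] htop' hK p
  rw [iSup_fin_three] at hF
  exact hF

/-- **… and the sub-sum `K₀ + K₁` meets `F^p` in `K₀ ∩ F^p + K₁ ∩ F^p`** when `K₂` is disjoint from
`K₀ + K₁` (modular law). This is the step «`M ∩ F² = (K ∩ F²) ⊕ (K' ∩ F²)`» of the cell's (C44)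
for a flat splitting `M = K ⊕ K'` inside `Hᵏ = M ⊕ M'`. [cite: VoisinHodgeI2002, §7.1.1 and §9.3.1 Prop. 9.20] -/
theorem HodgeStructure.sup_inf_F_eq_of_splitting (K₀ K₁ K₂ : Submodule ℂ (ℂ ⊗[ℚ] V))
    (htop : (K₀ ⊔ K₁) ⊔ K₂ = ⊤) (hdis : Disjoint (K₀ ⊔ K₁) K₂)
    (h₀ : K₀ = ⨆ q, K₀ ⊓ H.piece q (m - q))
    (h₁ : K₁ = ⨆ q, K₁ ⊓ H.piece q (m - q)) (h₂ : K₂ = ⨆ q, K₂ ⊓ H.piece q (m - q)) (p : ℤ) :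
    (K₀ ⊔ K₁) ⊓ H.F p = K₀ ⊓ H.F p ⊔ K₁ ⊓ H.F p := by
  have hF := HodgeStructure.F_eq_sup_three_of_splitting H K₀ K₁ K₂ htop h₀ h₁ h₂ p
  have hle : K₀ ⊓ H.F p ⊔ K₁ ⊓ H.F p ≤ K₀ ⊔ K₁ := sup_le_sup inf_le_left inf_le_left
  calc (K₀ ⊔ K₁) ⊓ H.F p = (K₀ ⊔ K₁) ⊓ ((K₀ ⊓ H.F p ⊔ K₁ ⊓ H.F p) ⊔ K₂ ⊓ H.F p) := by rw [← hF]
    _ = ((K₀ ⊓ H.F p ⊔ K₁ ⊓ H.F p) ⊔ K₂ ⊓ H.F p) ⊓ (K₀ ⊔ K₁) := inf_comm _ _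
    _ = (K₀ ⊓ H.F p ⊔ K₁ ⊓ H.F p) ⊔ (K₂ ⊓ H.F p) ⊓ (K₀ ⊔ K₁) := sup_inf_assoc_of_le _ hle
    _ = K₀ ⊓ H.F p ⊔ K₁ ⊓ H.F p := by
      rw [(hdis.symm.mono_left inf_le_left).eq_bot, sup_bot_eq]

/-- **The dimensions add up** for such a splitting with `K₀ ∩ K₁ = 0` and `(K₀ + K₁) ∩ K₂ = 0`:
`dim(K₀ ∩ F^p) + dim(K₁ ∩ F^p) + dim(K₂ ∩ F^p) = dim F^p` — the additivity hypothesis `hadd` of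
`flatSplitting_finrank_inf_F_eq_local` for the family `![K₀, K₁, K₂]`.
[cite: VoisinHodgeI2002, §7.1.1 and §9.3.1 Prop. 9.20] -/
theorem HodgeStructure.sum_three_finrank_inf_F_eq_of_splitting [FiniteDimensional ℚ V]
    (K₀ K₁ K₂ : Submodule ℂ (ℂ ⊗[ℚ] V))
    (htop : (K₀ ⊔ K₁) ⊔ K₂ = ⊤) (hdis₀₁ : Disjoint K₀ K₁) (hdis : Disjoint (K₀ ⊔ K₁) K₂)
    (h₀ : K₀ = ⨆ q, K₀ ⊓ H.piece q (m - q))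
    (h₁ : K₁ = ⨆ q, K₁ ⊓ H.piece q (m - q)) (h₂ : K₂ = ⨆ q, K₂ ⊓ H.piece q (m - q)) (p : ℤ) :
    ∑ j, finrank ℂ ↥((![K₀, K₁, K₂] : Fin 3 → Submodule ℂ (ℂ ⊗[ℚ] V)) j ⊓ H.F p) =
      finrank ℂ ↥(H.F p) := by
  have hF := HodgeStructure.F_eq_sup_three_of_splitting H K₀ K₁ K₂ htop h₀ h₁ h₂ p
  have hd₁ : K₀ ⊓ H.F p ⊓ (K₁ ⊓ H.F p) = ⊥ :=
    (hdis₀₁.mono inf_le_left inf_le_left).eq_bot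
  have hd₂ : (K₀ ⊓ H.F p ⊔ K₁ ⊓ H.F p) ⊓ (K₂ ⊓ H.F p) = ⊥ :=
    (hdis.mono (sup_le_sup inf_le_left inf_le_left) inf_le_left).eq_bot
  have e₁ := Submodule.finrank_sup_add_finrank_inf_eq (K₀ ⊓ H.F p) (K₁ ⊓ H.F p)
  rw [hd₁, finrank_bot, add_zero] at e₁
  have e₂ := Submodule.finrank_sup_add_finrank_inf_eq (K₀ ⊓ H.F p ⊔ K₁ ⊓ H.F p) (K₂ ⊓ H.F p)
  rw [hd₂, finrank_bot, add_zero, ← hF, e₁] at e₂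
  rw [Fin.sum_univ_three]
  exact e₂.symm

end Splitting

/-! ### §3 The criterion -/

section Main

variable {𝒳 S : SchemeOver ℂ}

/-- **A sub-variation whose `F^p`-line has full flat span at one member is irreducible under every
finite-index monodromy subgroup** (the cell's (C44) «FS-LEMMA» consumer). Setting: `f : 𝒳 → S` smooth
projective of relative dimension `n`, `𝒳`, `S` quasi-projective, `S` smooth of dimension `d`,
`Rᵏ f_* ℂ` locally trivial (`hU`), Hodge models `A t` with Hodge symmetry, base point `s`,
`H ≤ π₁(S(ℂ), s)` of finite index, `M ⊆ Hᵏ(X_s(ℂ); ℂ)` a non-zero `H`-stable complex SUB-VARIATION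
with `dim(M ∩ F^p) ≤ 1` (read on `ℂ ⊗_ℚ Hᵏ(X_s; ℚ)` through `β_s`). HYPOTHESIS (FS)_s: for every
proper subspace `P ⊊ β_s⁻¹M` and every open `W ∋ s` there is a member `t ∈ W`, joined to `s` inside
`W`, such that the Hodge filtration step `F^p(X_t)` pulled back to `s` by the rational transport
along that path meets `β_s⁻¹M` outside `P` («the flat span of the line `M ∩ F^p` near `s` is all
of `M`»). CONCLUSION: `M` is `H`-irreducible. PROOF: by Deligne 1987 (FACT B, relative Lemma E,
`exists_proper_subvariation_of_reducible_le` / `exists_isCompl_subvariation(_le)`) a reducible `M`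
splits as `K ⊕ K'` inside `Hᵏ = M ⊕ M'` with all pieces `H`-stable sub-variations; by Griffiths'
holomorphy (`flatSplitting_finrank_inf_F_eq_local`, Voisin I Prop. 9.20) the dimensions
`dim(K ∩ F^p(t))`, `dim(K' ∩ F^p(t))` are constant near `s`; they add up to `dim(M ∩ F^p) ≤ 1`, so
one of them vanishes identically and `M ∩ F^p(t) ⊆` the other piece for all nearby `t` —
contradicting (FS)_s. [cite: Deligne1987, §1.12–1.13 (p. 10–11)]
[cite: VoisinHodgeI2002, §9.3.1 Prop. 9.20 and §10.2.1 Thm. 10.3] -/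
theorem isTransportIrreducible_of_flatSpan
    (h : deligne1987_monodromy_directSum_irreducible_subvariations)
    (f : 𝒳 ⟶ S) (n k d : ℕ)
    (hf : IsSmoothProjectiveFamily f n) (hS : IsQuasiProjectiveOver S) (h𝒳 : IsQuasiProjectiveOver 𝒳)
    [AlgebraicGeometry.SmoothOfRelativeDimension d S.hom]
    (hU : IsCohomologicallyLocallyTrivialOn f (Set.univ : Set (ComplexPoints S)))
    (A : ∀ t : ComplexPoints S, HodgeModel n (fiberOver f t)) (hA : ∀ t, (A t).IsHodgeSymmetric)
    [∀ t, Module.Finite ℚ (singularCohomology ℚ ℚ (ComplexPoints (fiberOver f t)) k)]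
    (s : (Set.univ : Set (ComplexPoints S)))
    {H : Subgroup (FundamentalGroup (Set.univ : Set (ComplexPoints S)) s)} (hH : H.FiniteIndex)
    {M : Submodule ℂ (complexBetti (fiberOver f s.1) k)}
    (hMs : IsTransportStable f k hU s H M) (hMv : IsSubvariation f k hU n s M) (hM0 : M ≠ ⊥)
    (p : ℤ)
    (ha : finrank ℂ ↥(M.comap (ofRatClassBaseChangeEquiv (hf.isSmoothProjective s.1) k).toLinearMap ⊓
      ((A s.1).hodgeStructure (hf.isSmoothProjective s.1) (hA s.1) k).F p) ≤ 1)
    (hFS : ∀ P : Submodule ℂ (ℂ ⊗[ℚ] singularCohomology ℚ ℚ (ComplexPoints (fiberOver f s.1)) k),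
      P < M.comap (ofRatClassBaseChangeEquiv (hf.isSmoothProjective s.1) k).toLinearMap →
      ∀ W : Set (Set.univ : Set (ComplexPoints S)), IsOpen W → s ∈ W →
        ∃ t ∈ W, ∃ ε : Path s t, (∀ r, ε r ∈ W) ∧
          ∀ (T : singularCohomology ℚ ℚ (ComplexPoints (fiberOver f s.1)) k ≃ₗ[ℚ]
              singularCohomology ℚ ℚ (ComplexPoints (fiberOver f t.1)) k),
            (∀ v, ofRatClass _ k (T v) = transportFun f k hU ⟦ε⟧ (ofRatClass _ k v)) →
            ¬ (M.comap (ofRatClassBaseChangeEquiv (hf.isSmoothProjective s.1) k).toLinearMap ⊓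
                (((A t.1).hodgeStructure (hf.isSmoothProjective t.1) (hA t.1) k).comapEquiv T).F p
                  ≤ P)) :
    IsTransportIrreducible f k hU s H M := by
  classical
  haveI : Smooth S.hom := AlgebraicGeometry.SmoothOfRelativeDimension.smooth d S.hom
  have hXs : IsSmoothProjective n (fiberOver f s.1) := hf.isSmoothProjective s.1
  set e := ofRatClassBaseChangeEquiv (hf.isSmoothProjective s.1) k with he
  -- the order isomorphism `X ↦ β_s⁻¹ X` of subspace lattices
  set φ : Submodule ℂ (complexBetti (fiberOver f s.1) k) ≃o
      Submodule ℂ (ℂ ⊗[ℚ] singularCohomology ℚ ℚ (ComplexPoints (fiberOver f s.1)) k) :=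
    (Submodule.orderIsoMapComap e).symm with hφ
  have hφX : ∀ X : Submodule ℂ (complexBetti (fiberOver f s.1) k),
      φ X = X.comap e.toLinearMap := fun X ↦ rfl
  refine deligne1987_monodromy_directSum_irreducible_subvariations.isTransportIrreducible_of_forall_subvariation_eq
    h hf hS inferInstance hU hH hMs hMv hM0 fun K hKM hKs hKv ↦ ?_
  by_contra hne
  push Not at hne
  obtain ⟨hK0, hKM'⟩ := hne
  -- complements: `K ⊕ K' = M`, `M ⊕ M' = Hᵏ`, all `H`-stable sub-variations
  obtain ⟨K', hK'M, hKK', hKsup, hK's, hK'v⟩ :=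
    deligne1987_monodromy_directSum_irreducible_subvariations.exists_isCompl_subvariation_le
      h hf hS inferInstance hU hH hKM hKs hMs hMv
  obtain ⟨M', hMM', hM's, hM'v⟩ :=
    deligne1987_monodromy_directSum_irreducible_subvariations.exists_isCompl_subvariation
      h hf hS inferInstance hU hH hMs
  -- the three pieces read on `ℂ ⊗_ℚ Hᵏ(X_s; ℚ)`
  set K₀ := K.comap e.toLinearMap with hK₀
  set K₁ := K'.comap e.toLinearMap with hK₁
  set K₂ := M'.comap e.toLinearMap with hK₂
  have hM01 : M.comap e.toLinearMap = K₀ ⊔ K₁ := by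
    rw [hK₀, hK₁, ← hφX, ← hφX, ← hφX, ← hKsup]
    exact φ.map_sup K K'
  have hdis₀₁ : Disjoint K₀ K₁ := by
    rw [hK₀, hK₁, ← hφX, ← hφX]
    exact hKK'.map_orderIso φ
  have hdis : Disjoint (K₀ ⊔ K₁) K₂ := by
    rw [← hM01, hK₂, ← hφX, ← hφX]
    exact hMM'.disjoint.map_orderIso φ
  have htop : (K₀ ⊔ K₁) ⊔ K₂ = ⊤ := by
    rw [← hM01, hK₂, ← hφX, ← hφX, ← φ.map_sup, hMM'.sup_eq_top]
    exact map_top φ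
  -- Hodge compatibility of the three pieces at every continuation
  have hKpiece : ∀ (t : (Set.univ : Set (ComplexPoints S))) (γ : Path.Homotopic.Quotient s t)
      (T : singularCohomology ℚ ℚ (ComplexPoints (fiberOver f s.1)) k ≃ₗ[ℚ]
        singularCohomology ℚ ℚ (ComplexPoints (fiberOver f t.1)) k),
      (∀ v, ofRatClass _ k (T v) = transportFun f k hU γ (ofRatClass _ k v)) →
      ∀ L : Submodule ℂ (complexBetti (fiberOver f s.1) k), IsSubvariation f k hU n s L →
        L.comap e.toLinearMap = ⨆ q : ℤ, L.comap e.toLinearMap ⊓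
          (((A t.1).hodgeStructure (hf.isSmoothProjective t.1) (hA t.1) k).comapEquiv T).piece q
            ((k : ℤ) - q) :=
    fun t γ T hT L hL ↦ comap_eq_iSup_inf_piece_comapEquiv_of_isHodgeSubspace_map hT hXs
      (hf.isSmoothProjective t.1) (A t.1) (hA t.1) (hL t γ)
  -- the FS-lemma's neighbourhood of `s`
  obtain ⟨W, hWo, hsW, -, -, hW⟩ :=
    flatSplitting_finrank_inf_F_eq_local f n k d hf hS h𝒳 hU A hA s s Set.univ Filter.univ_mem
  have hT₁ : ∃ δ₁ : Path.Homotopic.Quotient s s, ∀ v,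
      ofRatClass _ k ((LinearEquiv.refl ℚ _) v) = transportFun f k hU δ₁ (ofRatClass _ k v) :=
    ⟨Path.Homotopic.Quotient.refl s, fun v ↦ by rw [LinearEquiv.refl_apply, transportFun_refl]⟩
  -- additivity of the dimensions at every continuation
  have hadd : ∀ t ∈ W, ∀ (ε : Path s t), (∀ r', ε r' ∈ W) →
      ∀ (T : singularCohomology ℚ ℚ (ComplexPoints (fiberOver f s.1)) k ≃ₗ[ℚ]
        singularCohomology ℚ ℚ (ComplexPoints (fiberOver f t.1)) k),
      (∀ v, ofRatClass _ k (T v) = transportFun f k hU ⟦ε⟧ (ofRatClass _ k ((LinearEquiv.refl ℚ _) v))) →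
      ∑ j, finrank ℂ ↥((![K₀, K₁, K₂] : Fin 3 → _) j ⊓
          (((A t.1).hodgeStructure (hf.isSmoothProjective t.1) (hA t.1) k).comapEquiv T).F p) =
        finrank ℂ ↥((((A t.1).hodgeStructure (hf.isSmoothProjective t.1) (hA t.1) k).comapEquiv T).F p) := by
    intro t _ ε _ T hT
    have hT' : ∀ v, ofRatClass _ k (T v) = transportFun f k hU ⟦ε⟧ (ofRatClass _ k v) := fun v ↦ by
      simpa only [LinearEquiv.refl_apply] using hT v
    exact HodgeStructure.sum_three_finrank_inf_F_eq_of_splitting _ K₀ K₁ K₂ htop hdis₀₁ hdis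
      (hKpiece t ⟦ε⟧ T hT' K hKv) (hKpiece t ⟦ε⟧ T hT' K' hK'v) (hKpiece t ⟦ε⟧ T hT' M' hM'v) p
  have hconst := hW (LinearEquiv.refl ℚ _) hT₁ p (![K₀, K₁, K₂] : Fin 3 → _) hadd
  -- reference values at `s`
  have hFs : (((A s.1).hodgeStructure (hf.isSmoothProjective s.1) (hA s.1) k).comapEquiv
      (LinearEquiv.refl ℚ _)).F p = ((A s.1).hodgeStructure (hf.isSmoothProjective s.1) (hA s.1) k).F p := by
    rw [Motives.HodgeStructure.comapEquiv_F, LinearEquiv.refl_toLinearMap, LinearMap.baseChange_id,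
      Submodule.comap_id]
  -- one of `dim(K₀ ∩ F^p)`, `dim(K₁ ∩ F^p)` vanishes at `s`
  set F₀ := ((A s.1).hodgeStructure (hf.isSmoothProjective s.1) (hA s.1) k).F p with hF₀
  have hsum_le : finrank ℂ ↥(K₀ ⊓ F₀) + finrank ℂ ↥(K₁ ⊓ F₀) ≤ 1 := by
    have e₁ := Submodule.finrank_sup_add_finrank_inf_eq (K₀ ⊓ F₀) (K₁ ⊓ F₀)
    rw [(hdis₀₁.mono inf_le_left inf_le_left).eq_bot, finrank_bot, add_zero] at e₁
    rw [← e₁]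
    refine le_trans (Submodule.finrank_mono ?_) ha
    rw [hM01]
    exact sup_le (inf_le_inf_right _ le_sup_left) (inf_le_inf_right _ le_sup_right)
  obtain ⟨j₀, j₁, hj, hPlt, hzero⟩ : ∃ j₀ j₁ : Fin 3, (j₀ = 0 ∧ j₁ = 1 ∨ j₀ = 1 ∧ j₁ = 0) ∧
      (![K₀, K₁, K₂] : Fin 3 → _) j₀ < M.comap e.toLinearMap ∧
      finrank ℂ ↥((![K₀, K₁, K₂] : Fin 3 → _) j₁ ⊓ F₀) = 0 := by
    have hK₀lt : K₀ < M.comap e.toLinearMap := by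
      refine lt_of_le_of_ne (hM01 ▸ le_sup_left) fun hEq ↦ hKM' ?_
      rw [hK₀, ← hφX, ← hφX] at hEq
      exact φ.injective hEq
    have hK₁lt : K₁ < M.comap e.toLinearMap := by
      refine lt_of_le_of_ne (hM01 ▸ le_sup_right) fun hEq ↦ hK0 ?_
      rw [hK₁, ← hφX, ← hφX] at hEq
      have hK'eq : K' = M := φ.injective hEq
      rw [hK'eq] at hKK'
      exact hKK'.eq_bot_of_le hKM
    rcases Nat.eq_zero_or_pos (finrank ℂ ↥(K₁ ⊓ F₀)) with h1 | h1
    · exact ⟨0, 1, Or.inl ⟨rfl, rfl⟩, hK₀lt, h1⟩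
    · exact ⟨1, 0, Or.inr ⟨rfl, rfl⟩, hK₁lt, by change finrank ℂ ↥(K₀ ⊓ F₀) = 0; omega⟩
  -- (FS)_s at the proper piece `K_{j₀}` inside `W`
  obtain ⟨t, htW, ε, hεW, hnot⟩ := hFS _ hPlt W hWo hsW
  obtain ⟨T, hT⟩ := exists_ratTransport f k hU (fun a b γ α hα ↦
    isRationalClass_transportFun_of_isSmoothProjectiveFamily (f := f) (k := k) d hf hS γ hα) (⟦ε⟧ : Path.Homotopic.Quotient s t)
  refine hnot T hT ?_
  -- at `(t, ε, T)`: `dim(K_{j₁} ∩ F^p(t,T)) = 0`, hence `β_s⁻¹M ∩ F^p(t,T) ⊆ K_{j₀}`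
  set Ft := (((A t.1).hodgeStructure (hf.isSmoothProjective t.1) (hA t.1) k).comapEquiv T).F p with hFt
  have hT' : ∀ v, ofRatClass _ k (T v) =
      transportFun f k hU ⟦ε⟧ (ofRatClass _ k ((LinearEquiv.refl ℚ _) v)) := fun v ↦ by
    rw [LinearEquiv.refl_apply]; exact hT v
  have hz : finrank ℂ ↥((![K₀, K₁, K₂] : Fin 3 → _) j₁ ⊓ Ft) = 0 := by
    have := hconst j₁ t htW ε hεW T hT'
    rw [hFs] at this
    rw [this, hzero]
  have hsplit : M.comap e.toLinearMap ⊓ Ft = K₀ ⊓ Ft ⊔ K₁ ⊓ Ft := by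
    rw [hM01]
    exact HodgeStructure.sup_inf_F_eq_of_splitting _ K₀ K₁ K₂ htop hdis
      (hKpiece t ⟦ε⟧ T hT K hKv) (hKpiece t ⟦ε⟧ T hT K' hK'v) (hKpiece t ⟦ε⟧ T hT M' hM'v) p
  rw [hsplit]
  rcases hj with ⟨rfl, rfl⟩ | ⟨rfl, rfl⟩
  · have hz' : K₁ ⊓ Ft = ⊥ := Submodule.finrank_eq_zero.1 hz
    rw [hz', sup_bot_eq]
    exact inf_le_left
  · have hz' : K₀ ⊓ Ft = ⊥ := Submodule.finrank_eq_zero.1 hz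
    rw [hz', bot_sup_eq]
    exact inf_le_left

/-- **Γ'-stable subspaces of `ℂ ⊗_ℚ Hᵏ(X_s; ℚ)` give transport-stable subspaces of `Hᵏ(X_s(ℂ); ℂ)`**
(the dictionary `σ : π₁ → Γ_s` of `ratMonodromyRep`): if `X` is stable under `γ ⊗ ℂ` for all `γ` in
a subgroup `Γ'` of `GL(Hᵏ(X_s; ℚ))`, then `β_s X` is stable under the transports of the loop
classes in `σ⁻¹(Γ')`. [cite: Deligne1987, §0 and §1.2 (p. 1, 2)] -/
theorem isTransportStable_map_of_forall_baseChange_mem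
    (f : 𝒳 ⟶ S) (n k d : ℕ) (hf : IsSmoothProjectiveFamily f n) (hS : IsQuasiProjectiveOver S)
    [AlgebraicGeometry.SmoothOfRelativeDimension d S.hom]
    (hU : IsCohomologicallyLocallyTrivialOn f (Set.univ : Set (ComplexPoints S)))
    (s : (Set.univ : Set (ComplexPoints S)))
    {Γ' : Subgroup (bettiCohomology (fiberOver f s.1) k ≃ₗ[ℚ] bettiCohomology (fiberOver f s.1) k)}
    {X : Submodule ℂ (ℂ ⊗[ℚ] bettiCohomology (fiberOver f s.1) k)}
    (hX : ∀ γ ∈ Γ', ∀ x ∈ X, ((γ : _ →ₗ[ℚ] _).baseChange ℂ) x ∈ X) :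
    IsTransportStable f k hU s
      (Γ'.comap (ratMonodromyRep f k hU (fun _ _ γ _ hα ↦
        isRationalClass_transportFun_of_isSmoothProjectiveFamily (f := f) (k := k) d hf hS γ hα) s))
      (X.map (ofRatClassBaseChangeEquiv (hf.isSmoothProjective s.1) k).toLinearMap) := by
  intro γ hγ w hw
  obtain ⟨x, hx, rfl⟩ := Submodule.mem_map.1 hw
  have hγ' := Subgroup.mem_comap.1 hγ
  refine Submodule.mem_map.2 ⟨_, hX _ hγ' x hx, ?_⟩
  simp only [LinearEquiv.coe_coe, ofRatClassBaseChangeEquiv_apply, loopTransport_apply]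
  exact ofRatClassBaseChange_baseChange_of_ratTransport
    (fun v ↦ by rw [ofRatClass_ratMonodromyRep_apply, loopTransport_apply]) x

/-- **The criterion in the currency of the cell's stub S4 (iii)** (`ℂ ⊗_ℚ Hᵏ(X_s; ℚ)`, finite-index
subgroups `Γ'` of the rational monodromy group `Γ_s = ratMonodromyGroup` acting through `γ ⊗ ℂ`):
let `Mi ⊆ ℂ ⊗_ℚ Hᵏ(X_s; ℚ)` be non-zero, `Γ'`-stable, with `β_s Mi` a complex sub-variation and
`dim(Mi ∩ F^p) ≤ 1`, and assume (FS)_s for `Mi` (no proper subspace of `Mi` contains the pulled-back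
`Mi ∩ F^p(X_t)` for all members `t` near `s`); then every `Γ'`-stable `F ⊆ Mi` is `0` or `Mi`.
(From `isTransportIrreducible_of_flatSpan` through `σ : π₁(S(ℂ), s) → Γ_s`, `[π₁ : σ⁻¹Γ'] = [Γ_s : Γ']`.)
[cite: Deligne1987, §1.12–1.13 (p. 10–11)] [cite: VoisinHodgeI2002, §9.3.1 Prop. 9.20 and §10.2.1 Thm. 10.3] -/
theorem eq_bot_or_eq_of_stable_of_flatSpan
    (h : deligne1987_monodromy_directSum_irreducible_subvariations)
    (f : 𝒳 ⟶ S) (n k d : ℕ)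
    (hf : IsSmoothProjectiveFamily f n) (hS : IsQuasiProjectiveOver S) (h𝒳 : IsQuasiProjectiveOver 𝒳)
    [AlgebraicGeometry.SmoothOfRelativeDimension d S.hom]
    (hU : IsCohomologicallyLocallyTrivialOn f (Set.univ : Set (ComplexPoints S)))
    (A : ∀ t : ComplexPoints S, HodgeModel n (fiberOver f t)) (hA : ∀ t, (A t).IsHodgeSymmetric)
    [∀ t, Module.Finite ℚ (singularCohomology ℚ ℚ (ComplexPoints (fiberOver f t)) k)]
    (s : (Set.univ : Set (ComplexPoints S)))
    {Mi : Submodule ℂ (ℂ ⊗[ℚ] bettiCohomology (fiberOver f s.1) k)}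
    (hMv : IsSubvariation f k hU n s
      (Mi.map (ofRatClassBaseChangeEquiv (hf.isSmoothProjective s.1) k).toLinearMap))
    (hM0 : Mi ≠ ⊥) (p : ℤ)
    (ha : finrank ℂ ↥(Mi ⊓ ((A s.1).hodgeStructure (hf.isSmoothProjective s.1) (hA s.1) k).F p) ≤ 1)
    (hFS : ∀ P : Submodule ℂ (ℂ ⊗[ℚ] bettiCohomology (fiberOver f s.1) k), P < Mi →
      ∀ W : Set (Set.univ : Set (ComplexPoints S)), IsOpen W → s ∈ W →
        ∃ t ∈ W, ∃ ε : Path s t, (∀ r, ε r ∈ W) ∧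
          ∀ (T : bettiCohomology (fiberOver f s.1) k ≃ₗ[ℚ] bettiCohomology (fiberOver f t.1) k),
            (∀ v, ofRatClass _ k (T v) = transportFun f k hU ⟦ε⟧ (ofRatClass _ k v)) →
            ¬ (Mi ⊓ (((A t.1).hodgeStructure (hf.isSmoothProjective t.1) (hA t.1) k).comapEquiv T).F p
                  ≤ P))
    {Γ' : Subgroup (bettiCohomology (fiberOver f s.1) k ≃ₗ[ℚ] bettiCohomology (fiberOver f s.1) k)}
    (hfi : (Γ'.subgroupOf (ratMonodromyGroup f k hU s)).FiniteIndex)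
    (hstab : ∀ γ ∈ Γ', ∀ x ∈ Mi, ((γ : _ →ₗ[ℚ] _).baseChange ℂ) x ∈ Mi)
    (F : Submodule ℂ (ℂ ⊗[ℚ] bettiCohomology (fiberOver f s.1) k)) (hFM : F ≤ Mi)
    (hFstab : ∀ γ ∈ Γ', ∀ x ∈ F, ((γ : _ →ₗ[ℚ] _).baseChange ℂ) x ∈ F) :
    F = ⊥ ∨ F = Mi := by
  set e := ofRatClassBaseChangeEquiv (hf.isSmoothProjective s.1) k with he
  have hrat : ∀ (a b : (Set.univ : Set (ComplexPoints S))) (γ : Path.Homotopic.Quotient a b)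
      (α : complexBetti (fiberOver f a.1) k),
      IsRationalClass α → IsRationalClass (transportFun f k hU γ α) :=
    fun _ _ γ _ hα ↦ isRationalClass_transportFun_of_isSmoothProjectiveFamily (f := f) (k := k) d hf hS γ hα
  set H := Γ'.comap (ratMonodromyRep f k hU hrat s) with hH
  have hHfi : H.FiniteIndex := finiteIndex_comap_ratMonodromyRep f k hU hrat s hfi
  have hMs : IsTransportStable f k hU s H (Mi.map e.toLinearMap) :=
    isTransportStable_map_of_forall_baseChange_mem f n k d hf hS hU s hstab
  have hFs : IsTransportStable f k hU s H (F.map e.toLinearMap) :=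
    isTransportStable_map_of_forall_baseChange_mem f n k d hf hS hU s hFstab
  have hcm : (Mi.map e.toLinearMap).comap e.toLinearMap = Mi :=
    Submodule.comap_map_eq_of_injective e.injective Mi
  have hirr : IsTransportIrreducible f k hU s H (Mi.map e.toLinearMap) := by
    refine isTransportIrreducible_of_flatSpan h f n k d hf hS h𝒳 hU A hA s hHfi hMs hMv
      (fun h0 ↦ hM0 ((Submodule.map_eq_bot_iff (e := e)).1 h0)) p ?_ ?_
    · rw [hcm]; exact ha
    · rw [hcm]; exact hFS
  rcases hirr.2 (F.map e.toLinearMap) (Submodule.map_mono hFM) hFs with h0 | h1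
  · exact Or.inl ((Submodule.map_eq_bot_iff (e := e)).1 h0)
  · exact Or.inr (Submodule.map_injective_of_injective e.injective h1)

end Main

end HodgeTheory

end Literature.AlgebraicGeometry.HodgeTheory

end
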